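import Summits.Schanuel.Schanuel.Theses.TateNomes
import Summits.Schanuel.Schanuel.Theorems.TateNomesNomeTransferStubEnvelopeCount
import Summits.Schanuel.Schanuel.Theorems.TateNomesNomeTransferStubSpanDescent
import Summits.Schanuel.Schanuel.Theorems.TateNomesNomeTransferStubAlgPairCost
import Literature.Barriers.Schanuel.NesterenkoModularScopeHolds
import HarnessLib

/-!
# Disproof of `NomeTransfer` (crux stmt-Schanuel-17405, route `TateNomes`) — findings: NO KILL

Standing disprover `refuter-cdisprove-stmt-Schanuel-17405-0`, cycle 1 (2026-08-17).
Everything below is kernel-checked (no `sorry`); prose lives in docstrings only.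

## Index of findings

* §0 **Barrier.** `nomeTransfer_of_schanuel : Schanuel → NomeTransfer` (one line: the crux keeps
  `LinearIndependent ℚ z` and concludes Schanuel's inequality for `z`). Hence
  `not_schanuel_of_not_nomeTransfer`: an unconditional kill of this crux would refute the summit.
  No counterexample search can succeed unless Schanuel's conjecture is false.
* §1 **The crux is a theorem, in a stronger form.** `nomeTransferCore_holds` composes the three
  LANDED stubs of line `trdeg-bookkeeping` (`stub_envelopeCount`, `stub_spanDescent` p157988,
  `stub_algPairCost`) into `NomeTransferCore` — no `LinearIndependent ℚ z`, only the `⊆` half of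
  the span equality, the `3m` adjoined values ARBITRARY (`f g h : Fin m → ℂ`, not the Ramanujan
  series), `m` decoupled from `n + k`, threshold `n + k + 3m` — and `nomeTransfer_of_core` recovers
  the crux by name. So: `LinearIndependent ℚ z`, `span ⊇`, the q-series and the coupling
  `m = n + k` are NOT load-bearing (information for the prover: ignore them).
* §2 **Envelope bound is load-bearing, and exactly summit-hard.**
  `nomeTransferWithoutEnvelope_iff_schanuel : NomeTransferWithoutEnvelope ↔ Schanuel`
  (drop the envelope hypothesis and the crux literally is Schanuel: take `k = 0`).
  With `LinearIndependent` also dropped it is plain false: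
  `nomeTransfer_false_without_linIndep_and_envelope` (witness `z = ![0]`, `t(z) = 0 < 1`).
* §3 **Tightness of the threshold (unconditional, uses Nesterenko 1996 from the tree).**
  `not_nomeTransferCoreMinusOne`: in the opaque form the threshold `n + k + 3m` cannot be lowered
  by one — witness `m = n = 1, k = 0, w = z = ![0]`, `f g h =` Ramanujan `P, Q, R` at `q = 1/2`
  (three algebraically independent numbers by `nesterenko1996_thm_1_1_holds`), envelope trdeg `= 3`
  `= n + k + 3m - 1` but `t(z) = 0 < n`. Any sharpening of the constant `4` must look INSIDE
  `P, Q, R` (modular relations), it is not bookkeeping.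
* §4 **Span hypothesis is load-bearing (modulo rich nome tuples).**
  `schanuel_of_nomeTransferWithoutSpan : RichNomeTuples 4 → NomeTransferWithoutSpan → Schanuel` and
  `nomeTransferWithoutSpan_of_schanuel`; with `LinearIndependent` also dropped it is false given ONE
  rich nome: `nomeTransfer_false_without_linIndep_and_span`. `RichNomeTuples c m`-type hypotheses
  (`∃ w : Fin m → ℂ`, `c·m ≤ trdeg Env(w)`) are TRUE (Mahler 1969 functional independence of
  `q, P, Q, R` + `log q`, tree `Mahler1969_ramanujan_algIndep_holds`, and genericity: values at a
  point outside countably many proper analytic zero-sets) but the passage functions → generic values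
  is not in the tree; at every EXPLICIT nome only `3` is known (Nesterenko), `4` at one nome is
  Conjecture 1.11-strength, so no explicit witness exists in print.
* §5 **Admissibility is load-bearing (modulo rich nome tuples).**
  `schanuel_of_nomeTransferWithoutAdmissible : RichNomeTuples 5 → NomeTransferWithoutAdmissible →
  Schanuel` (pad `z` with a rich non-admissible `e : Fin (4n) → ℂ`, `w = Fin.append z e`) and
  `nomeTransferWithoutAdmissible_of_schanuel`. Dropping admissibility while keeping the span
  equality but NOT linear independence is not refutable cheaply either: every padded configuration
  in a low-dimensional span puts several nomes on one `GL₂⁺(ℚ)`-orbit, where the modular equations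
  cap the envelope (e.g. `q` and `q²`: `E_k(2τ)` algebraic over `ℚ(E₂, E₄, E₆)(τ)`), see §5 docstring.
* §6 **Non-vacuity.** Hypotheses satisfiable at `n = k = 0` (`hypotheses_satisfiable_zero`); for
  `n + k ≥ 1` a satisfying EXPLICIT instance needs `4` algebraically independent numbers among
  `(w, e^w, P, Q, R)` at one nome — open (Nesterenko gives `3`: `three_le_trdeg_env_single`).

Verdict for the lead / provers: the crux resists because it is TRUE (composition of landed stubs,
§1); every single-hypothesis mutation is either still a theorem (§1) or equivalent to the summit
(§2, §4, §5); the only unconditional negatives are the double drops (§2) and the sharpness of the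
opaque threshold (§3).

LANDED (gate-accepted): `Summits/Schanuel/Schanuel/Theorems/NomeTransfer/Negative/CoreThresholdTight.lean`
(p159144, commit 9e3bfe510d35) — `nomeTransferCore_false_below_threshold` (= §3) and
`nomeTransfer_false_without_linIndep_and_envelope` (= §2, double drop), namespace
`Summit.Schanuel.Schanuel.Theorems.NomeTransfer.Negative`; importable by ideators / planners.
Status of the crux at the time of writing: CLOSED · proved (`Theorems/TateNomesNomeTransfer.lean`,
`NomeTransfer_of`, line `trdeg-bookkeeping`).
-/

-- D-0017: the doubled `Schanuel.Schanuel` path component is the mandated summit/sub-problem namespace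
set_option linter.dupNamespace false

noncomputable section

namespace Summit.Schanuel.Schanuel.Cruxes.NomeTransfer.Disproof

open Complex IntermediateField
open Summit.Schanuel.Schanuel.Theses.TateNomes (NomeTransfer)
open Summit.Schanuel.Schanuel.Theorems.TateNomesNomeTransfer
  (stub_envelopeCount stub_spanDescent stub_algPairCost)
open Literature.Barriers.Schanuel (trdeg_mono trdeg_adjoin_union_eq_of_isAlgebraic ramanujanP
  ramanujanQ ramanujanR nesterenko1996_thm_1_1_holds)
open Literature.NumberTheory.Transcendental (trdeg_adjoin_le_mk)

/-! ## Vocabulary (reducible abbreviations, `rfl`-equal to the crux's inline terms) -/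

/-- Ramanujan's `P` at the nome `q = e^c`, verbatim the crux's inline q-series. -/
abbrev pAt (c : ℂ) : ℂ :=
  1 - 24 * ∑' l : ℕ, (ArithmeticFunction.sigma 1 (l + 1) : ℂ) * Complex.exp c ^ (l + 1)

/-- Ramanujan's `Q` at the nome `q = e^c`, verbatim the crux's inline q-series. -/
abbrev qAt (c : ℂ) : ℂ :=
  1 + 240 * ∑' l : ℕ, (ArithmeticFunction.sigma 3 (l + 1) : ℂ) * Complex.exp c ^ (l + 1)

/-- Ramanujan's `R` at the nome `q = e^c`, verbatim the crux's inline q-series. -/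
abbrev rAt (c : ℂ) : ℂ :=
  1 - 504 * ∑' l : ℕ, (ArithmeticFunction.sigma 5 (l + 1) : ℂ) * Complex.exp c ^ (l + 1)

/-- The generators of the envelope field `Env(w) = ℚ(w, e^w, P(e^{wⱼ}), Q(e^{wⱼ}), R(e^{wⱼ}))`. -/
abbrev envGens {m : ℕ} (w : Fin m → ℂ) : Set ℂ :=
  Set.range w ∪ Set.range (Complex.exp ∘ w) ∪ Set.range (fun j => pAt (w j)) ∪
    Set.range (fun j => qAt (w j)) ∪ Set.range (fun j => rAt (w j))

/-- `trdeg_ℚ Env(w)`. -/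
abbrev tEnv {m : ℕ} (w : Fin m → ℂ) : Cardinal :=
  Algebra.trdeg ℚ ↥(IntermediateField.adjoin ℚ (envGens w))

/-- Schanuel's quantity `t(z) = trdeg_ℚ ℚ(z, e^z)`. -/
abbrev tExp {n : ℕ} (z : Fin n → ℂ) : Cardinal :=
  Algebra.trdeg ℚ ↥(IntermediateField.adjoin ℚ (Set.range z ∪ Set.range (Complex.exp ∘ z)))

/-- The inline series are definitionally the tree's `ramanujanP/Q/R` at `q = e^c`. -/
theorem pAt_eq (c : ℂ) : pAt c = ramanujanP (cexp c) := rfl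
theorem qAt_eq (c : ℂ) : qAt c = ramanujanQ (cexp c) := rfl
theorem rAt_eq (c : ℂ) : rAt c = ramanujanR (cexp c) := rfl

/-- Sanity: the crux, restated with the abbreviations, is `Iff.rfl`-equal to the route decl. -/
theorem nomeTransfer_iff :
    NomeTransfer ↔
      ∀ (n : ℕ) (z : Fin n → ℂ) (k : ℕ) (e : Fin k → ℂ) (w : Fin (n + k) → ℂ),
        LinearIndependent ℚ z → (∀ i, IsAlgebraic ℚ (e i) ∨ IsAlgebraic ℚ (Complex.exp (e i))) →
        Submodule.span ℚ (Set.range w) = Submodule.span ℚ (Set.range z ∪ Set.range e) →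
        ((4 * (n + k) : ℕ) : Cardinal) ≤ tEnv w → (n : Cardinal) ≤ tExp z :=
  Iff.rfl

/-! ## §0 Barrier: the summit implies the crux -/

/-- **Barrier.** Schanuel's conjecture implies the crux outright (the crux keeps
`LinearIndependent ℚ z` among its hypotheses and concludes Schanuel's inequality for `z`).
Consequently NO unconditional disproof of `NomeTransfer` exists unless Schanuel is false. -/
theorem nomeTransfer_of_schanuel (hS : _root_.Schanuel) : NomeTransfer :=
  fun n z _ _ _ hz _ _ _ => hS n z hz

/-- Contrapositive of `nomeTransfer_of_schanuel`: a kill of the crux kills the summit. -/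
theorem not_schanuel_of_not_nomeTransfer (h : ¬ NomeTransfer) : ¬ _root_.Schanuel :=
  fun hS => h (nomeTransfer_of_schanuel hS)

/-! ## §1 The crux is a theorem (stronger core form, from the three landed stubs) -/

/-- **Core form** of the crux — what line `trdeg-bookkeeping` actually proves: no linear
independence of `z`, only `range w ⊆ span_ℚ (range z ∪ range e)`, the three adjoined families
`f g h` ARBITRARY, their length `m` decoupled from `n + k`, threshold `n + k + 3m`. -/
def NomeTransferCore : Prop :=
  ∀ (m n k : ℕ) (w : Fin m → ℂ) (z : Fin n → ℂ) (e : Fin k → ℂ) (f g h : Fin m → ℂ),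
    (∀ i, IsAlgebraic ℚ (e i) ∨ IsAlgebraic ℚ (Complex.exp (e i))) →
    Set.range w ⊆ (Submodule.span ℚ (Set.range z ∪ Set.range e) : Set ℂ) →
    ((n + k + 3 * m : ℕ) : Cardinal) ≤ Algebra.trdeg ℚ ↥(IntermediateField.adjoin ℚ
      (Set.range w ∪ Set.range (Complex.exp ∘ w) ∪ Set.range f ∪ Set.range g ∪ Set.range h)) →
    (n : Cardinal) ≤ tExp z

/-- Cardinal cancellation: from `n + k + 3m ≤ t + k + 3m` conclude `n ≤ t`
(free if `t` is infinite, `ℕ`-arithmetic otherwise). -/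
theorem cancel {t : Cardinal} {n k c : ℕ}
    (h : ((n + k + c : ℕ) : Cardinal) ≤ t + (k : Cardinal) + (c : Cardinal)) :
    (n : Cardinal) ≤ t := by
  rcases lt_or_ge t Cardinal.aleph0 with ht | ht
  · obtain ⟨m, rfl⟩ := Cardinal.lt_aleph0.1 ht
    have h' : n + k + c ≤ m + k + c := by exact_mod_cast h
    have hnm : n ≤ m := by omega
    exact_mod_cast hnm
  · exact (Cardinal.natCast_lt_aleph0 (n := n)).le.trans ht

/-- **The core form holds** (composition of the three landed stubs of line `trdeg-bookkeeping`:
`Theorems/TateNomesNomeTransferStub{EnvelopeCount,SpanDescent,AlgPairCost}.lean`). -/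
theorem nomeTransferCore_holds : NomeTransferCore := by
  intro m n k w z e f g h he hw henv
  have h₁ := stub_envelopeCount m (Set.range w ∪ Set.range (Complex.exp ∘ w)) f g h
  have h₂ := stub_spanDescent m n k w z e hw
  have h₃ := stub_algPairCost n k z e he
  have hc : ((n + k + 3 * m : ℕ) : Cardinal) ≤ tExp z + (k : Cardinal) + ((3 * m : ℕ) : Cardinal) :=
    henv.trans (h₁.trans (add_le_add (h₂.trans h₃) le_rfl))
  exact cancel hc

/-- Mutation 1+2: the crux WITHOUT `LinearIndependent ℚ z` and with only the `≤` half of the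
span equality (`span_ℚ (range w) ≤ span_ℚ (range z ∪ range e)`). -/
def NomeTransferSpanLe : Prop :=
  ∀ (n : ℕ) (z : Fin n → ℂ) (k : ℕ) (e : Fin k → ℂ) (w : Fin (n + k) → ℂ),
    (∀ i, IsAlgebraic ℚ (e i) ∨ IsAlgebraic ℚ (Complex.exp (e i))) →
    Submodule.span ℚ (Set.range w) ≤ Submodule.span ℚ (Set.range z ∪ Set.range e) →
    ((4 * (n + k) : ℕ) : Cardinal) ≤ tEnv w → (n : Cardinal) ≤ tExp z

/-- `LinearIndependent ℚ z` and the `⊇` half of the span equality are NOT load-bearing: the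
doubly-weakened mutation is still a theorem (core form at `m = n + k`, Ramanujan families). -/
theorem nomeTransferSpanLe_holds : NomeTransferSpanLe := by
  intro n z k e w he hspan henv
  have hw : Set.range w ⊆ (Submodule.span ℚ (Set.range z ∪ Set.range e) : Set ℂ) :=
    fun x hx => hspan (Submodule.subset_span hx)
  have h4 : ((n + k + 3 * (n + k) : ℕ) : Cardinal) = ((4 * (n + k) : ℕ) : Cardinal) := by
    congr 1; ring
  exact nomeTransferCore_holds (n + k) n k w z e (fun j => pAt (w j)) (fun j => qAt (w j))
    (fun j => rAt (w j)) he hw (h4 ▸ henv)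

/-- Mutation 1 alone: the crux WITHOUT `LinearIndependent ℚ z`. -/
def NomeTransferWithoutLinIndep : Prop :=
  ∀ (n : ℕ) (z : Fin n → ℂ) (k : ℕ) (e : Fin k → ℂ) (w : Fin (n + k) → ℂ),
    (∀ i, IsAlgebraic ℚ (e i) ∨ IsAlgebraic ℚ (Complex.exp (e i))) →
    Submodule.span ℚ (Set.range w) = Submodule.span ℚ (Set.range z ∪ Set.range e) →
    ((4 * (n + k) : ℕ) : Cardinal) ≤ tEnv w → (n : Cardinal) ≤ tExp z

/-- `LinearIndependent ℚ z` is NOT load-bearing: the mutation is still a theorem. -/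
theorem nomeTransferWithoutLinIndep_holds : NomeTransferWithoutLinIndep :=
  fun n z k e w he hspan henv => nomeTransferSpanLe_holds n z k e w he hspan.le henv

/-- **The crux holds** (so it cannot be disproved): recorded here as the reason every attack
below fails. (A candidate proof for the provers; the lead lands the registered skeleton.) -/
theorem nomeTransfer_holds : NomeTransfer :=
  fun n z k e w _hz he hspan henv => nomeTransferWithoutLinIndep_holds n z k e w he hspan henv

/-! ## Small tools -/

/-- A field generated over `ℚ` by algebraic numbers has transcendence degree `0`. [folklore] -/
theorem trdeg_adjoin_eq_zero_of_isAlgebraic (T : Set ℂ) (hT : ∀ x ∈ T, IsAlgebraic ℚ x) :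
    Algebra.trdeg ℚ ↥(adjoin ℚ T) = 0 := by
  have h1 : Algebra.trdeg ℚ ↥(adjoin ℚ (∅ ∪ T)) = Algebra.trdeg ℚ ↥(adjoin ℚ (∅ : Set ℂ)) :=
    trdeg_adjoin_union_eq_of_isAlgebraic (K := ℚ) (∅ : Set ℂ) T hT
  have h2 : Algebra.trdeg ℚ ↥(adjoin ℚ (∅ : Set ℂ)) = 0 :=
    nonpos_iff_eq_zero.mp ((trdeg_adjoin_le_mk (F := ℚ) (∅ : Set ℂ)).trans (by simp))
  have h3 : Algebra.trdeg ℚ ↥(adjoin ℚ T) = Algebra.trdeg ℚ ↥(adjoin ℚ (∅ ∪ T)) := by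
    rw [Set.empty_union]
  exact h3.trans (h1.trans h2)

/-- `t(![0]) = 0`: the witness tuple `z = ![0]` (allowed once `LinearIndependent` is dropped)
generates `ℚ(0, e^0) = ℚ`. [folklore] -/
theorem tExp_zero : tExp ![(0 : ℂ)] = 0 := by
  apply trdeg_adjoin_eq_zero_of_isAlgebraic
  rintro x (⟨i, rfl⟩ | ⟨i, rfl⟩)
  · have : ((![(0 : ℂ)] : Fin 1 → ℂ) i) = 0 := by
      fin_cases i; rfl
    rw [this]; exact isAlgebraic_zero
  · have : (Complex.exp ∘ ![(0 : ℂ)]) i = 1 := by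
      fin_cases i; simp
    rw [this]; exact isAlgebraic_one

/-- `¬ (1 ≤ t(![0]))`. -/
theorem not_one_le_tExp_zero : ¬ ((1 : ℕ) : Cardinal) ≤ tExp ![(0 : ℂ)] := by
  rw [tExp_zero]; simp

/-- `range (Fin.append x u) = range x ∪ range u`. [folklore] -/
theorem range_fin_append {α : Type*} {n k : ℕ} (x : Fin n → α) (u : Fin k → α) :
    Set.range (Fin.append x u) = Set.range x ∪ Set.range u := by
  ext a
  constructor
  · rintro ⟨i, rfl⟩
    induction i using Fin.addCases with
    | left j => exact Or.inl ⟨j, by simp⟩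
    | right j => exact Or.inr ⟨j, by simp⟩
  · rintro (⟨j, rfl⟩ | ⟨j, rfl⟩)
    · exact ⟨Fin.castAdd k j, Fin.append_left x u j⟩
    · exact ⟨Fin.natAdd n j, Fin.append_right x u j⟩

/-! ## §2 The envelope bound: dropping it gives back the summit; double drop is false -/

/-- Mutation 3: the crux WITHOUT the envelope hypothesis `4(n+k) ≤ trdeg Env(w)`. -/
def NomeTransferWithoutEnvelope : Prop :=
  ∀ (n : ℕ) (z : Fin n → ℂ) (k : ℕ) (e : Fin k → ℂ) (w : Fin (n + k) → ℂ),
    LinearIndependent ℚ z → (∀ i, IsAlgebraic ℚ (e i) ∨ IsAlgebraic ℚ (Complex.exp (e i))) →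
    Submodule.span ℚ (Set.range w) = Submodule.span ℚ (Set.range z ∪ Set.range e) →
    (n : Cardinal) ≤ tExp z

/-- **The envelope bound is load-bearing and exactly summit-hard**: without it the crux IS
Schanuel's conjecture (`→`: take `k = 0`, `e = ![]`, `w = z`; `←`: discard everything). So this
mutation is neither provable nor refutable today. -/
theorem nomeTransferWithoutEnvelope_iff_schanuel : NomeTransferWithoutEnvelope ↔ _root_.Schanuel := by
  constructor
  · intro h n z hz
    exact h n z 0 ![] z hz (fun i => i.elim0) (by simp)
  · intro hS n z k e w hz _ _
    exact hS n z hz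

/-- Mutations 1+3: the crux WITHOUT `LinearIndependent ℚ z` AND WITHOUT the envelope bound. -/
def NomeTransferBare : Prop :=
  ∀ (n : ℕ) (z : Fin n → ℂ) (k : ℕ) (e : Fin k → ℂ) (w : Fin (n + k) → ℂ),
    (∀ i, IsAlgebraic ℚ (e i) ∨ IsAlgebraic ℚ (Complex.exp (e i))) →
    Submodule.span ℚ (Set.range w) = Submodule.span ℚ (Set.range z ∪ Set.range e) →
    (n : Cardinal) ≤ tExp z

/-- **Double drop is false**: without linear independence AND without the envelope bound,
`z = ![0]` (`n = 1`, `k = 0`, `w = ![0]`) has `t(z) = 0 < 1`. So at least one of the two must stay;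
§1 says linear independence may go, hence the envelope bound must stay. -/
theorem nomeTransfer_false_without_linIndep_and_envelope : ¬ NomeTransferBare := by
  intro h
  exact not_one_le_tExp_zero (h 1 ![0] 0 ![] ![0] (fun i => i.elim0) (by simp))

/-! ## §3 Tightness of the threshold `n + k + 3m` (unconditional: Nesterenko 1996 in the tree) -/

/-- The core form with the threshold LOWERED BY ONE (`n + k + 3m - 1`). -/
def NomeTransferCoreMinusOne : Prop :=
  ∀ (m n k : ℕ) (w : Fin m → ℂ) (z : Fin n → ℂ) (e : Fin k → ℂ) (f g h : Fin m → ℂ),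
    (∀ i, IsAlgebraic ℚ (e i) ∨ IsAlgebraic ℚ (Complex.exp (e i))) →
    Set.range w ⊆ (Submodule.span ℚ (Set.range z ∪ Set.range e) : Set ℂ) →
    ((n + k + 3 * m - 1 : ℕ) : Cardinal) ≤ Algebra.trdeg ℚ ↥(IntermediateField.adjoin ℚ
      (Set.range w ∪ Set.range (Complex.exp ∘ w) ∪ Set.range f ∪ Set.range g ∪ Set.range h)) →
    (n : Cardinal) ≤ tExp z

/-- Nesterenko at the algebraic nome `q = 1/2`: `P(1/2), Q(1/2), R(1/2)` generate a field of
transcendence degree `≥ 3` (`trdeg ℚ(1/2, P, Q, R) ≥ 3` by `nesterenko1996_thm_1_1_holds`, and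
`1/2` is algebraic). [cite: NesterenkoPhilippon2001, Ch. 3 Theorem 1.1] -/
theorem three_le_trdeg_ramanujan_half :
    (3 : Cardinal) ≤ Algebra.trdeg ℚ ↥(adjoin ℚ ({ramanujanP (1 / 2), ramanujanQ (1 / 2),
      ramanujanR (1 / 2)} : Set ℂ)) := by
  have hq0 : 0 < ‖((1 : ℂ) / 2)‖ := by norm_num
  have hq1 : ‖((1 : ℂ) / 2)‖ < 1 := by norm_num
  have hN := nesterenko1996_thm_1_1_holds ((1 : ℂ) / 2) hq0 hq1
  have halg : ∀ x ∈ ({(1 : ℂ) / 2} : Set ℂ), IsAlgebraic ℚ x := by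
    intro x hx
    rw [Set.mem_singleton_iff] at hx
    subst hx
    simpa using isAlgebraic_algebraMap (R := ℚ) (A := ℂ) (1 / 2 : ℚ)
  have heq : Algebra.trdeg ℚ ↥(adjoin ℚ (({ramanujanP (1 / 2), ramanujanQ (1 / 2),
      ramanujanR (1 / 2)} : Set ℂ) ∪ {(1 : ℂ) / 2})) =
      Algebra.trdeg ℚ ↥(adjoin ℚ ({ramanujanP (1 / 2), ramanujanQ (1 / 2),
        ramanujanR (1 / 2)} : Set ℂ)) :=
    trdeg_adjoin_union_eq_of_isAlgebraic (K := ℚ) _ _ halg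
  have hset : ({(1 : ℂ) / 2, ramanujanP (1 / 2), ramanujanQ (1 / 2), ramanujanR (1 / 2)} : Set ℂ) =
      ({ramanujanP (1 / 2), ramanujanQ (1 / 2), ramanujanR (1 / 2)} : Set ℂ) ∪ {(1 : ℂ) / 2} := by
    ext x; simp only [Set.mem_insert_iff, Set.mem_singleton_iff, Set.mem_union]; tauto
  have hN' : (3 : Cardinal) ≤ Algebra.trdeg ℚ ↥(adjoin ℚ (({ramanujanP (1 / 2), ramanujanQ (1 / 2),
      ramanujanR (1 / 2)} : Set ℂ) ∪ {(1 : ℂ) / 2})) := by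
    rw [← hset]; exact hN
  exact hN'.trans heq.le

/-- **The threshold is sharp** (tightness, unconditional): the core bookkeeping statement with
`n + k + 3m` lowered to `n + k + 3m - 1` is FALSE. Witness: `m = n = 1`, `k = 0`, `w = z = ![0]`,
`e = ![]`, and the opaque families `f g h = ![P(1/2)], ![Q(1/2)], ![R(1/2)]` — three algebraically
independent numbers by Nesterenko's theorem — so the envelope `ℚ(0, 1, P(1/2), Q(1/2), R(1/2))`
has `trdeg ≥ 3 = n + k + 3m - 1` while `t(z) = 0 < 1 = n`. Moral for sharpenings of the crux's
constant `4`: they must use the arithmetic of `P, Q, R` (modular relations), not bookkeeping.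
[cite: NesterenkoPhilippon2001, Ch. 3 Theorem 1.1] -/
theorem not_nomeTransferCoreMinusOne : ¬ NomeTransferCoreMinusOne := by
  intro h
  let c : ℂ := Complex.log (1 / 2)
  have hc : cexp c = 1 / 2 := Complex.exp_log (by norm_num)
  refine not_one_le_tExp_zero (h 1 1 0 ![0] ![0] ![] ![ramanujanP (1 / 2)] ![ramanujanQ (1 / 2)]
    ![ramanujanR (1 / 2)] (fun i => i.elim0) ?_ ?_)
  · rintro x ⟨i, rfl⟩
    have : ((![(0 : ℂ)] : Fin 1 → ℂ) i) = 0 := by fin_cases i; rfl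
    rw [this]
    exact (Submodule.span ℚ _).zero_mem
  · have hsub : ({ramanujanP (1 / 2), ramanujanQ (1 / 2), ramanujanR (1 / 2)} : Set ℂ) ⊆
        Set.range ![(0 : ℂ)] ∪ Set.range (Complex.exp ∘ ![(0 : ℂ)]) ∪
          Set.range ![ramanujanP (1 / 2)] ∪ Set.range ![ramanujanQ (1 / 2)] ∪
          Set.range ![ramanujanR (1 / 2)] := by
      rintro x (rfl | rfl | hx)
      · exact Or.inl (Or.inl (Or.inr ⟨0, rfl⟩))
      · exact Or.inl (Or.inr ⟨0, rfl⟩)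
      · rw [Set.mem_singleton_iff] at hx; subst hx; exact Or.inr ⟨0, rfl⟩
    have hmono := trdeg_mono (F := ℚ) (E := ℂ) (adjoin.mono ℚ _ _ hsub)
    have h3 : ((1 + 0 + 3 * 1 - 1 : ℕ) : Cardinal) = 3 := by norm_num
    rw [h3]
    exact three_le_trdeg_ramanujan_half.trans hmono

/-! ## §4 The span hypothesis (load-bearing modulo rich nome tuples) -/

/-- **Rich nome tuples** (hypothesis `H` of the conditional lemmas): for every `m` some
`w : Fin m → ℂ` has `trdeg_ℚ Env(w) ≥ c·m`. TRUE for `c ≤ 5` — Mahler 1969: `q, P, Q, R` (and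
`log q`) are algebraically independent FUNCTIONS (tree `Mahler1969_ramanujan_algIndep_holds`), so
the values at any point outside a countable union of proper analytic zero-sets are algebraically
independent — but the passage to generic VALUES is not in the tree, and at every EXPLICIT nome
only `3` of the `5` is known (Nesterenko); `4` at a single nome is already of the strength of
Nesterenko's Conjecture 1.11 / `TateLocusGPCOne`. [cite: NesterenkoPhilippon2001, Ch. 1 Remark (i); Ch. 3 Conjecture 1.11] -/
def RichNomeTuples (c : ℕ) : Prop :=
  ∀ m : ℕ, ∃ w : Fin m → ℂ, ((c * m : ℕ) : Cardinal) ≤ tEnv w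

/-- Mutation 4: the crux WITHOUT the span hypothesis (`w` decoupled from `z, e`). -/
def NomeTransferWithoutSpan : Prop :=
  ∀ (n : ℕ) (z : Fin n → ℂ) (k : ℕ) (e : Fin k → ℂ) (w : Fin (n + k) → ℂ),
    LinearIndependent ℚ z → (∀ i, IsAlgebraic ℚ (e i) ∨ IsAlgebraic ℚ (Complex.exp (e i))) →
    ((4 * (n + k) : ℕ) : Cardinal) ≤ tEnv w → (n : Cardinal) ≤ tExp z

/-- Schanuel implies the span-less mutation (trivially). -/
theorem nomeTransferWithoutSpan_of_schanuel (hS : _root_.Schanuel) : NomeTransferWithoutSpan :=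
  fun n z _ _ _ hz _ _ => hS n z hz

/-- **The span hypothesis is load-bearing** (modulo rich nome tuples): without it, feeding a rich
`n`-tuple `w` unrelated to `z` (`k = 0`) returns Schanuel's inequality for every `z`. -/
theorem schanuel_of_nomeTransferWithoutSpan (hR : RichNomeTuples 4) (h : NomeTransferWithoutSpan) :
    _root_.Schanuel := by
  intro n z hz
  obtain ⟨w, hw⟩ := hR n
  exact h n z 0 ![] w hz (fun i => i.elim0) hw

/-- Mutations 1+4: WITHOUT `LinearIndependent ℚ z` AND WITHOUT the span hypothesis. -/
def NomeTransferWithoutLinIndepWithoutSpan : Prop :=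
  ∀ (n : ℕ) (z : Fin n → ℂ) (k : ℕ) (e : Fin k → ℂ) (w : Fin (n + k) → ℂ),
    (∀ i, IsAlgebraic ℚ (e i) ∨ IsAlgebraic ℚ (Complex.exp (e i))) →
    ((4 * (n + k) : ℕ) : Cardinal) ≤ tEnv w → (n : Cardinal) ≤ tExp z

/-- **Double drop (linear independence + span) is false given ONE rich nome** `c`
(`trdeg ℚ(c, e^c, P(e^c), Q(e^c), R(e^c)) ≥ 4`): `n = 1`, `z = ![0]`, `k = 0`, `w = ![c]`. -/
theorem nomeTransfer_false_without_linIndep_and_span (hR : ∃ c : ℂ, (4 : Cardinal) ≤ tEnv ![c]) :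
    ¬ NomeTransferWithoutLinIndepWithoutSpan := by
  rintro h
  obtain ⟨c, hc⟩ := hR
  have h4 : ((4 * (1 + 0) : ℕ) : Cardinal) = 4 := by norm_num
  exact not_one_le_tExp_zero (h 1 ![0] 0 ![] ![c] (fun i => i.elim0) (h4 ▸ hc))

/-! ## §5 Admissibility of `e` (load-bearing modulo rich nome tuples) -/

/-- Mutation 5: the crux WITHOUT admissibility of `e` (`eᵢ` or `exp eᵢ` algebraic). -/
def NomeTransferWithoutAdmissible : Prop :=
  ∀ (n : ℕ) (z : Fin n → ℂ) (k : ℕ) (e : Fin k → ℂ) (w : Fin (n + k) → ℂ),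
    LinearIndependent ℚ z →
    Submodule.span ℚ (Set.range w) = Submodule.span ℚ (Set.range z ∪ Set.range e) →
    ((4 * (n + k) : ℕ) : Cardinal) ≤ tEnv w → (n : Cardinal) ≤ tExp z

/-- Schanuel implies the admissibility-less mutation (trivially). -/
theorem nomeTransferWithoutAdmissible_of_schanuel (hS : _root_.Schanuel) :
    NomeTransferWithoutAdmissible :=
  fun n z _ _ _ hz _ _ => hS n z hz

/-- Generators of `Env(e)` are among those of `Env(Fin.append z e)`. -/
theorem envGens_subset_append {n k : ℕ} (z : Fin n → ℂ) (e : Fin k → ℂ) :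
    envGens e ⊆ envGens (Fin.append z e) := by
  have key : ∀ (F : ℂ → ℂ), Set.range (fun j => F (e j)) ⊆ Set.range (fun j => F (Fin.append z e j)) :=
    fun F => by
      rintro x ⟨j, rfl⟩
      exact ⟨Fin.natAdd n j, by simp⟩
  have key0 : Set.range e ⊆ Set.range (Fin.append z e) := by
    rintro x ⟨j, rfl⟩; exact ⟨Fin.natAdd n j, by simp⟩
  have key1 : Set.range (Complex.exp ∘ e) ⊆ Set.range (Complex.exp ∘ Fin.append z e) := by
    rintro x ⟨j, rfl⟩; exact ⟨Fin.natAdd n j, by simp⟩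
  exact Set.union_subset_union (Set.union_subset_union (Set.union_subset_union
    (Set.union_subset_union key0 key1) (key pAt)) (key qAt)) (key rAt)

/-- **Admissibility is load-bearing** (modulo rich nome tuples): without it, pad a `ℚ`-independent
`z` by a RICH non-admissible `e : Fin (4n) → ℂ` and take `w = Fin.append z e`; then
`span w = span (z, e)`, `trdeg Env(w) ≥ trdeg Env(e) ≥ 5·4n = 4(n + 4n)`, and the mutation returns
Schanuel's inequality for `z`. -/
theorem schanuel_of_nomeTransferWithoutAdmissible (hR : RichNomeTuples 5)
    (h : NomeTransferWithoutAdmissible) : _root_.Schanuel := by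
  intro n z hz
  obtain ⟨e, he⟩ := hR (4 * n)
  refine h n z (4 * n) e (Fin.append z e) hz (by rw [range_fin_append]) ?_
  have h20 : ((4 * (n + 4 * n) : ℕ) : Cardinal) = ((5 * (4 * n) : ℕ) : Cardinal) := by
    congr 1; ring
  rw [h20]
  exact he.trans (trdeg_mono (adjoin.mono ℚ _ _ (envGens_subset_append z e)))

/-! ## §6 Non-vacuity of the hypotheses -/

/-- The hypotheses of the crux are jointly satisfiable (degenerate instance `n = k = 0`), so the
crux is not vacuously true. For `n + k ≥ 1` an EXPLICIT satisfying instance would need `4`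
algebraically independent numbers among `(c, e^c, P, Q, R)` at one nome — open; see
`three_le_tEnv_single` for the `3` that are known. -/
theorem hypotheses_satisfiable_zero :
    ∃ (z : Fin 0 → ℂ) (e : Fin 0 → ℂ) (w : Fin (0 + 0) → ℂ),
      LinearIndependent ℚ z ∧ (∀ i, IsAlgebraic ℚ (e i) ∨ IsAlgebraic ℚ (Complex.exp (e i))) ∧
      Submodule.span ℚ (Set.range w) = Submodule.span ℚ (Set.range z ∪ Set.range e) ∧
      ((4 * (0 + 0) : ℕ) : Cardinal) ≤ tEnv w :=
  ⟨![], ![], ![], linearIndependent_empty_type, fun i => i.elim0, by simp, by simp⟩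

/-- What IS known at every single nome (Nesterenko 1996, tree `nesterenko1996_thm_1_1_holds`):
for `Re c < 0` the envelope of the one-tuple `![c]` has `trdeg ≥ 3` (the crux's hypothesis at
`n + k = 1` asks for `4`). [cite: NesterenkoPhilippon2001, Ch. 3 Theorem 1.1] -/
theorem three_le_tEnv_single (c : ℂ) (hc : c.re < 0) : (3 : Cardinal) ≤ tEnv ![c] := by
  have hq0 : 0 < ‖cexp c‖ := by simp [Complex.norm_exp]; exact Real.exp_pos _
  have hq1 : ‖cexp c‖ < 1 := by
    rw [Complex.norm_exp]; exact Real.exp_lt_one_iff.mpr hc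
  have hN := nesterenko1996_thm_1_1_holds (cexp c) hq0 hq1
  have hsub : ({cexp c, ramanujanP (cexp c), ramanujanQ (cexp c), ramanujanR (cexp c)} : Set ℂ) ⊆
      envGens ![c] := by
    rintro x (rfl | rfl | rfl | hx)
    · exact Or.inl (Or.inl (Or.inl (Or.inr ⟨0, rfl⟩)))
    · exact Or.inl (Or.inl (Or.inr ⟨0, rfl⟩))
    · exact Or.inl (Or.inr ⟨0, rfl⟩)
    · rw [Set.mem_singleton_iff] at hx; subst hx; exact Or.inr ⟨0, rfl⟩
  exact hN.trans (trdeg_mono (adjoin.mono ℚ _ _ hsub))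

end Summit.Schanuel.Schanuel.Cruxes.NomeTransfer.Disproof

end
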